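import Summits.BirchSwinnertonDyer.BirchSwinnertonDyer.Theses.UniversalToricDescent
import Summits.BirchSwinnertonDyer.BirchSwinnertonDyer.Theorems.UniversalToricDescentTwinSplitIMCAtThreeOfThreeFrames
import Summits.BirchSwinnertonDyer.BirchSwinnertonDyer.Theorems.UniversalToricDescentSelfMuZeroAtThree
import HarnessLib

/-!
# SKELETON v4 (line `threeframes`, RESHAPED 2026-08-28 ≈00:30Z by lead bsd-wall-utd-p2 g7) for child crux `TwinSplitIMCAtThreeGoodSS`
# (stmt-BirchSwinnertonDyer-20695): the two research `∃`-frame stubs of v3 SPLIT BY `a₃` (the `a₃ = 0` halves = the port-shaped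
# statements that ALONE bear the crux on the Hessian type; the `a₃ ≠ 0` halves = preprint-only ♯/♭) + the by-name fact stub

History: v1 = utd-p2 g2 / utd-idea g6 (cd65a53edf482fd3: howardFrameSS / wanFrameSS / muFrameSS); v3 = g4 (155dcab4167cf6ab:
howardFrameSS / wanFrameSS / thmB; the `μ`-frame derived from Hsieh Thm B). RESHAPE v4 (L4, recommended by g5 SUPSET-AT3-v8 §5 and
made load-bearing by g7): the twin-choice kernel (p576995/p579334, g6) consumes crux #3 at ONE twin, and on the `3`-adic type
`(v₃c₄, v₃c₆) = (4, ≥7)` of ALL `603` bucket-C classes that twin can be taken to be the HESSIAN `D(0:1)`, which is good supersingular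
with `a₃ = 0` (g7, PROVED: `Theorems/UniversalToricDescentHessianTwinAtThree.lean` p583681; kernel by name
`UniversalToricDescentHessianTwin.bsdp_three_of_apZero_on_hessianType`, p584193). Hence the `a₃ = 0` halves of the two frame stubs are
the critical path and the `a₃ ≠ 0` halves (CÇSS18 ♯/♭, preprint-only) are off it on the type. Stub list (5 ≤ stubs_max):
* `stub_howardFrameSS_apZero` — ONE BDP frame inside `Ch_Λ(X_{∅,0})·R₀⟦T⟧` at a good-ss twin with `a₃ = 0`: PORT of Castella–Wan Thm 5.12
  (± Heegner-point Kolyvagin system divisibility) to `p = 3`; carriers refereed at `3` (Hatley–Lei–Vigni 2022). HARDEST-but-port.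
* `stub_wanFrameSS_apZero` — the rational Wan frame at `a₃ = 0`: PORT of CW24 ± ERL + §6.1 first half to `p = 3`. Research/port.
* `stub_howardFrameSS_apNonzero`, `stub_wanFrameSS_apNonzero` — the `a₃ = ±3` halves: PREPRINT-ONLY (CÇSS18 Thm 5.7/5.8 ♯/♭); NOT
  load-bearing on the Hessian type (census 603/603).
* `stub_thmB` — BY-NAME refereed fact (Hsieh 2014 Thm. B any level), unchanged from v3.
The v3 stubs are DERIVED below by excluded middle on `a₃ = 0` (`howardFrameSS` = p574340 `stub_howardFrameSS_of_apZero_of_apNeZero`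
inlined; `wanFrameSS` likewise), and `TwinSplitIMCAtThreeGoodSS_of` concludes the child BY NAME exactly as in v3
(`twinSplit_instance_of_three_frames`, p543791). Status memo: HOME/bsd-wall-utd-p2/SUPSET-AT3-v10.md.
-/

noncomputable section

open scoped Classical

set_option linter.dupNamespace false
set_option autoImplicit false

namespace Summit.BirchSwinnertonDyer.BirchSwinnertonDyer.Cruxes.TwinSplitIMCAtThreeGoodSS.ThreeFrames

open PowerSeries WeierstrassCurve NumberField IsDedekindDomain Field
  Literature.NumberTheory.EllipticCurves
  Literature.NumberTheory.EllipticCurves.ModularForms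
  Literature.NumberTheory.EllipticCurves.Rank1Residual
  Summit.BirchSwinnertonDyer.Rank1Residual.X11b
  Summit.BirchSwinnertonDyer.Rank1Residual.X11b.Halves
  Summit.BirchSwinnertonDyer.BirchSwinnertonDyer.Theorems.SchneiderFree
  Summit.BirchSwinnertonDyer.BirchSwinnertonDyer.Theorems.UniversalToricDescentTwinSplit

/-- STUB (`a₃ = 0` half of the Howard frame at a good-supersingular twin: ONE BDP frame inside `Ch_Λ(X_{∅,0})·R₀⟦T⟧`;
= PORT of Castella–Wan Thm 5.12 to `p = 3`, `a_p = 0`; the load-bearing half on the Hessian type). -/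
theorem stub_howardFrameSS_apZero :
    ∀ (W' : WeierstrassCurve ℚ) [W'.IsElliptic] [W'.IsGloballyMinimal] (N' : ℕ) [NeZero N']
      (K : Type) [Field K] [NumberField K] (Dt' : ModularParametrizationData W' N'),
      GoodSS W' 3 → W'.frobeniusTrace 3 = 0 → W'.HasSurjectiveModNGaloisRep 3 → W'.conductorNorm ℤ = N' → IsImaginaryQuadratic K →
      SatisfiesHeegnerHypothesis N' K → Odd (NumberField.discr K) →
      ∀ (κ : ZpExtension K 3), κ.IsAnticyclotomic → ∀ (γ : absoluteGaloisGroup K) [Fact (κ.IsTopGenerator γ)]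
        (𝔭 : HeightOneSpectrum (𝓞 K)), ((3 : ℕ) : 𝓞 K) ∈ 𝔭.asIdeal →
        𝔭.asIdeal.ramificationIdx (𝓞 ℚ) = 1 → 𝔭.asIdeal.inertiaDeg (𝓞 ℚ) = 1 →
        ∀ (𝔭' : HeightOneSpectrum (𝓞 K)), ((3 : ℕ) : 𝓞 K) ∈ 𝔭'.asIdeal → 𝔭' ≠ 𝔭 →
        ∀ (ι' : PadicAlgCl 3 ≃+* ℂ), BranchInducesPrime 3 ι' 𝔭 →
        ∃ (ΩK : ℂ) (Ωp : ℂ_[3]) (L : UnrSeries 3), ΩK ≠ 0 ∧ Ωp ≠ 0 ∧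
          IsBDPLFunction ι' 𝔭 κ γ Dt'.f ΩK Ωp L ∧
          L ∈ (AcSelmer.XAc.charIdeal (W'.baseChange K) 3 κ 𝔭' ∅ γ).map (PowerSeries.map (toUnr 3)) := by
  sorry

/-- STUB (`a₃ ≠ 0` half of the Howard frame: `a₃ = ±3`, PREPRINT-ONLY — CÇSS18 ♯/♭ Thm 5.7 + Lemma 5.5 at `p = 3`, PRE claim
p545192; NOT load-bearing on the Hessian type). -/
theorem stub_howardFrameSS_apNonzero :
    ∀ (W' : WeierstrassCurve ℚ) [W'.IsElliptic] [W'.IsGloballyMinimal] (N' : ℕ) [NeZero N']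
      (K : Type) [Field K] [NumberField K] (Dt' : ModularParametrizationData W' N'),
      GoodSS W' 3 → W'.frobeniusTrace 3 ≠ 0 → W'.HasSurjectiveModNGaloisRep 3 → W'.conductorNorm ℤ = N' → IsImaginaryQuadratic K →
      SatisfiesHeegnerHypothesis N' K → Odd (NumberField.discr K) →
      ∀ (κ : ZpExtension K 3), κ.IsAnticyclotomic → ∀ (γ : absoluteGaloisGroup K) [Fact (κ.IsTopGenerator γ)]
        (𝔭 : HeightOneSpectrum (𝓞 K)), ((3 : ℕ) : 𝓞 K) ∈ 𝔭.asIdeal →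
        𝔭.asIdeal.ramificationIdx (𝓞 ℚ) = 1 → 𝔭.asIdeal.inertiaDeg (𝓞 ℚ) = 1 →
        ∀ (𝔭' : HeightOneSpectrum (𝓞 K)), ((3 : ℕ) : 𝓞 K) ∈ 𝔭'.asIdeal → 𝔭' ≠ 𝔭 →
        ∀ (ι' : PadicAlgCl 3 ≃+* ℂ), BranchInducesPrime 3 ι' 𝔭 →
        ∃ (ΩK : ℂ) (Ωp : ℂ_[3]) (L : UnrSeries 3), ΩK ≠ 0 ∧ Ωp ≠ 0 ∧
          IsBDPLFunction ι' 𝔭 κ γ Dt'.f ΩK Ωp L ∧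
          L ∈ (AcSelmer.XAc.charIdeal (W'.baseChange K) 3 κ 𝔭' ∅ γ).map (PowerSeries.map (toUnr 3)) := by
  sorry

/-- DERIVED (v3's `stub_howardFrameSS`, no sorry of its own): excluded middle on `a₃ = 0` (= p574340
`HowardSplitByA3.stub_howardFrameSS_of_apZero_of_apNeZero`, inlined). -/
theorem stub_howardFrameSS :
    ∀ (W' : WeierstrassCurve ℚ) [W'.IsElliptic] [W'.IsGloballyMinimal] (N' : ℕ) [NeZero N']
      (K : Type) [Field K] [NumberField K] (Dt' : ModularParametrizationData W' N'),
      GoodSS W' 3 → W'.HasSurjectiveModNGaloisRep 3 → W'.conductorNorm ℤ = N' → IsImaginaryQuadratic K →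
      SatisfiesHeegnerHypothesis N' K → Odd (NumberField.discr K) →
      ∀ (κ : ZpExtension K 3), κ.IsAnticyclotomic → ∀ (γ : absoluteGaloisGroup K) [Fact (κ.IsTopGenerator γ)]
        (𝔭 : HeightOneSpectrum (𝓞 K)), ((3 : ℕ) : 𝓞 K) ∈ 𝔭.asIdeal →
        𝔭.asIdeal.ramificationIdx (𝓞 ℚ) = 1 → 𝔭.asIdeal.inertiaDeg (𝓞 ℚ) = 1 →
        ∀ (𝔭' : HeightOneSpectrum (𝓞 K)), ((3 : ℕ) : 𝓞 K) ∈ 𝔭'.asIdeal → 𝔭' ≠ 𝔭 →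
        ∀ (ι' : PadicAlgCl 3 ≃+* ℂ), BranchInducesPrime 3 ι' 𝔭 →
        ∃ (ΩK : ℂ) (Ωp : ℂ_[3]) (L : UnrSeries 3), ΩK ≠ 0 ∧ Ωp ≠ 0 ∧
          IsBDPLFunction ι' 𝔭 κ γ Dt'.f ΩK Ωp L ∧
          L ∈ (AcSelmer.XAc.charIdeal (W'.baseChange K) 3 κ 𝔭' ∅ γ).map (PowerSeries.map (toUnr 3)) := by
  intro W' _ _ N' _ K _ _ Dt' hss hsurj
  by_cases ha : W'.frobeniusTrace 3 = 0
  · exact stub_howardFrameSS_apZero W' N' K Dt' hss ha hsurj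
  · exact stub_howardFrameSS_apNonzero W' N' K Dt' hss ha hsurj

/-- STUB (`a₃ = 0` half of the rational Wan frame at a good-supersingular twin under the CLASSICAL Heegner hypothesis:
= PORT of CW24 ± explicit reciprocity law + §6.1 first half to `p = 3`; research/port, the load-bearing half on the Hessian type). -/
theorem stub_wanFrameSS_apZero :
    ∀ (W' : WeierstrassCurve ℚ) [W'.IsElliptic] [W'.IsGloballyMinimal] (N' : ℕ) [NeZero N']
      (K : Type) [Field K] [NumberField K] (Dt' : ModularParametrizationData W' N'),
      GoodSS W' 3 → W'.frobeniusTrace 3 = 0 → W'.HasSurjectiveModNGaloisRep 3 → W'.conductorNorm ℤ = N' → IsImaginaryQuadratic K →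
      SatisfiesHeegnerHypothesis N' K → Odd (NumberField.discr K) →
      ∀ (κ : ZpExtension K 3), κ.IsAnticyclotomic → ∀ (γ : absoluteGaloisGroup K) [Fact (κ.IsTopGenerator γ)]
        (𝔭 : HeightOneSpectrum (𝓞 K)), ((3 : ℕ) : 𝓞 K) ∈ 𝔭.asIdeal →
        𝔭.asIdeal.ramificationIdx (𝓞 ℚ) = 1 → 𝔭.asIdeal.inertiaDeg (𝓞 ℚ) = 1 →
        ∀ (𝔭' : HeightOneSpectrum (𝓞 K)), ((3 : ℕ) : 𝓞 K) ∈ 𝔭'.asIdeal → 𝔭' ≠ 𝔭 →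
        ∀ (ι' : PadicAlgCl 3 ≃+* ℂ), BranchInducesPrime 3 ι' 𝔭 →
        ∃ (ΩK : ℂ) (Ωp : ℂ_[3]) (L : UnrSeries 3), ΩK ≠ 0 ∧ Ωp ≠ 0 ∧
          IsBDPLFunction ι' 𝔭 κ γ Dt'.f ΩK Ωp L ∧
          ∃ k : ℕ, ∀ G ∈ (AcSelmer.XAc.charIdeal (W'.baseChange K) 3 κ 𝔭' ∅ γ).map
            (PowerSeries.map (toUnr 3)), PowerSeries.C (((3 : ℕ) : unrIntegers 3) ^ k) * G ∈ Ideal.span {L} := by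
  sorry

/-- STUB (`a₃ ≠ 0` half of the rational Wan frame: `a₃ = ±3`, PREPRINT-ONLY ♯/♭ currency (CÇSS18 Thm 5.8); NOT load-bearing
on the Hessian type). -/
theorem stub_wanFrameSS_apNonzero :
    ∀ (W' : WeierstrassCurve ℚ) [W'.IsElliptic] [W'.IsGloballyMinimal] (N' : ℕ) [NeZero N']
      (K : Type) [Field K] [NumberField K] (Dt' : ModularParametrizationData W' N'),
      GoodSS W' 3 → W'.frobeniusTrace 3 ≠ 0 → W'.HasSurjectiveModNGaloisRep 3 → W'.conductorNorm ℤ = N' → IsImaginaryQuadratic K →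
      SatisfiesHeegnerHypothesis N' K → Odd (NumberField.discr K) →
      ∀ (κ : ZpExtension K 3), κ.IsAnticyclotomic → ∀ (γ : absoluteGaloisGroup K) [Fact (κ.IsTopGenerator γ)]
        (𝔭 : HeightOneSpectrum (𝓞 K)), ((3 : ℕ) : 𝓞 K) ∈ 𝔭.asIdeal →
        𝔭.asIdeal.ramificationIdx (𝓞 ℚ) = 1 → 𝔭.asIdeal.inertiaDeg (𝓞 ℚ) = 1 →
        ∀ (𝔭' : HeightOneSpectrum (𝓞 K)), ((3 : ℕ) : 𝓞 K) ∈ 𝔭'.asIdeal → 𝔭' ≠ 𝔭 →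
        ∀ (ι' : PadicAlgCl 3 ≃+* ℂ), BranchInducesPrime 3 ι' 𝔭 →
        ∃ (ΩK : ℂ) (Ωp : ℂ_[3]) (L : UnrSeries 3), ΩK ≠ 0 ∧ Ωp ≠ 0 ∧
          IsBDPLFunction ι' 𝔭 κ γ Dt'.f ΩK Ωp L ∧
          ∃ k : ℕ, ∀ G ∈ (AcSelmer.XAc.charIdeal (W'.baseChange K) 3 κ 𝔭' ∅ γ).map
            (PowerSeries.map (toUnr 3)), PowerSeries.C (((3 : ℕ) : unrIntegers 3) ^ k) * G ∈ Ideal.span {L} := by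
  sorry

/-- DERIVED (v3's `stub_wanFrameSS`, no sorry of its own): excluded middle on `a₃ = 0`. -/
theorem stub_wanFrameSS :
    ∀ (W' : WeierstrassCurve ℚ) [W'.IsElliptic] [W'.IsGloballyMinimal] (N' : ℕ) [NeZero N']
      (K : Type) [Field K] [NumberField K] (Dt' : ModularParametrizationData W' N'),
      GoodSS W' 3 → W'.HasSurjectiveModNGaloisRep 3 → W'.conductorNorm ℤ = N' → IsImaginaryQuadratic K →
      SatisfiesHeegnerHypothesis N' K → Odd (NumberField.discr K) →
      ∀ (κ : ZpExtension K 3), κ.IsAnticyclotomic → ∀ (γ : absoluteGaloisGroup K) [Fact (κ.IsTopGenerator γ)]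
        (𝔭 : HeightOneSpectrum (𝓞 K)), ((3 : ℕ) : 𝓞 K) ∈ 𝔭.asIdeal →
        𝔭.asIdeal.ramificationIdx (𝓞 ℚ) = 1 → 𝔭.asIdeal.inertiaDeg (𝓞 ℚ) = 1 →
        ∀ (𝔭' : HeightOneSpectrum (𝓞 K)), ((3 : ℕ) : 𝓞 K) ∈ 𝔭'.asIdeal → 𝔭' ≠ 𝔭 →
        ∀ (ι' : PadicAlgCl 3 ≃+* ℂ), BranchInducesPrime 3 ι' 𝔭 →
        ∃ (ΩK : ℂ) (Ωp : ℂ_[3]) (L : UnrSeries 3), ΩK ≠ 0 ∧ Ωp ≠ 0 ∧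
          IsBDPLFunction ι' 𝔭 κ γ Dt'.f ΩK Ωp L ∧
          ∃ k : ℕ, ∀ G ∈ (AcSelmer.XAc.charIdeal (W'.baseChange K) 3 κ 𝔭' ∅ γ).map
            (PowerSeries.map (toUnr 3)), PowerSeries.C (((3 : ℕ) : unrIntegers 3) ^ k) * G ∈ Ideal.span {L} := by
  intro W' _ _ N' _ K _ _ Dt' hss hsurj
  by_cases ha : W'.frobeniusTrace 3 = 0
  · exact stub_wanFrameSS_apZero W' N' K Dt' hss ha hsurj
  · exact stub_wanFrameSS_apNonzero W' N' K Dt' hss ha hsurj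

/-- STUB (BY-NAME, refereed; closes only by formalisation): Hsieh 2014 Thm. B at every level — for a weight-2 newform
`f`, `p` odd split in `K`, classical Heegner hypothesis, absolutely irreducible residual representation over `K`: an
anticyclotomic `p`-adic `L`-function `Q ∈ 𝓞_{ℂ_p}⟦T⟧` with unramified `p`-adic period and a coefficient of norm one
(`μ = 0`). [cite: Hsieh2014, Thm. B p. 712 (Doc. Math. 19)] -/
theorem stub_thmB : Hsieh2014.thmB_exists_isHsiehLFunction_coeff_norm_eq_one_unrPeriod_anyLevel := by
  sorry

/-- DERIVED (no sorry of its own): every `R₀`-frame of `f_W` has a UNIT coefficient, at ANY reduction type at `3`, from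
`stub_thmB` — utd-p1 g4's ♭-witness `self_exists_isBDPLFunctionInt_coeff_norm_eq_one` moved across periods and
receptacles by `exists_coeff_norm_eq_one_of_isBDPLFunctionInt_of_isBDPLFunction` (p538896), read through
`unrIntegers.isUnit_iff_norm_eq_one`. (= landed `Theorems.exists_isUnit_coeff_of_isBDPLFunction_of_thmB`, p569658.)
[cite: Hsieh2014, Thm. B p. 712 (Doc. Math. 19)] -/
theorem exists_isUnit_coeff_of_frame
    (W : WeierstrassCurve ℚ) [W.IsElliptic] (N : ℕ) [NeZero N]
    (K : Type) [Field K] [NumberField K] (Dt : ModularParametrizationData W N)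
    (honto : W.HasSurjectiveModNGaloisRep 3) (hK : IsImaginaryQuadratic K)
    (hH : SatisfiesHeegnerHypothesis N K) (κ : ZpExtension K 3) (hκ : κ.IsAnticyclotomic)
    (γ : absoluteGaloisGroup K) [Fact (κ.IsTopGenerator γ)]
    (𝔭 : HeightOneSpectrum (𝓞 K)) (h𝔭 : ((3 : ℕ) : 𝓞 K) ∈ 𝔭.asIdeal)
    (he : 𝔭.asIdeal.ramificationIdx (𝓞 ℚ) = 1) (hf : 𝔭.asIdeal.inertiaDeg (𝓞 ℚ) = 1)
    (ι' : PadicAlgCl 3 ≃+* ℂ) (hι' : BranchInducesPrime 3 ι' 𝔭)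
    {ΩK : ℂ} {Ωp : ℂ_[3]} {L : UnrSeries 3} (hΩK : ΩK ≠ 0) (hΩp : Ωp ≠ 0)
    (hL : IsBDPLFunction ι' 𝔭 κ γ Dt.f ΩK Ωp L) :
    ∃ i : ℕ, IsUnit (PowerSeries.coeff i L) := by
  obtain ⟨ΩK₁, Ωp₁, Q, hΩK₁, hΩp₁, hQ, hμQ⟩ :=
    Summit.BirchSwinnertonDyer.BirchSwinnertonDyer.Theorems.UniversalToricDescentSelfMuZero.self_exists_isBDPLFunctionInt_coeff_norm_eq_one stub_thmB W N K Dt honto hK hH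
      κ hκ γ 𝔭 h𝔭 he hf ι' hι'
  have hΩp₁0 : Ωp₁ ≠ 0 := fun h ↦ by rw [h, norm_zero] at hΩp₁; exact zero_ne_one hΩp₁
  obtain ⟨i, hi⟩ :=
    Summit.BirchSwinnertonDyer.BirchSwinnertonDyer.Theorems.UniversalToricDescentFlatMuTransfer.exists_coeff_norm_eq_one_of_isBDPLFunctionInt_of_isBDPLFunction hK hκ
      Fact.out hΩK₁ hΩK hΩp₁0 hΩp hQ hL hμQ
  exact ⟨i, (unrIntegers.isUnit_iff_norm_eq_one _).mpr hi⟩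

/-- COMPOSITION: the two frame stubs and the by-name fact give the child crux BY NAME
(`twinSplit_instance_of_three_frames`, p543791; the `μ`-frame is the Howard frame, unit coefficient by
`exists_isUnit_coeff_of_frame`). -/
theorem TwinSplitIMCAtThreeGoodSS_of :
    Summit.BirchSwinnertonDyer.BirchSwinnertonDyer.Theses.UniversalToricDescent.TwinSplitIMCAtThreeGoodSS := by
  intro W' _ _ N' _ K _ _ Dt' hss hsurj hN' hK hH hodd κ hκ γ _ 𝔭 h𝔭 he hf 𝔭' h𝔭' hne ι' hι'
  have hH1 := stub_howardFrameSS W' N' K Dt' hss hsurj hN' hK hH hodd κ hκ γ 𝔭 h𝔭 he hf 𝔭' h𝔭' hne ι' hι'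
  have hMu : ∃ (ΩK : ℂ) (Ωp : ℂ_[3]) (L : UnrSeries 3), ΩK ≠ 0 ∧ Ωp ≠ 0 ∧
      IsBDPLFunction ι' 𝔭 κ γ Dt'.f ΩK Ωp L ∧ ∃ i : ℕ, IsUnit (PowerSeries.coeff i L) := by
    obtain ⟨ΩK, Ωp, L, hΩK, hΩp, hL, -⟩ := hH1
    exact ⟨ΩK, Ωp, L, hΩK, hΩp, hL, exists_isUnit_coeff_of_frame W' N' K Dt' hsurj hK hH κ hκ γ 𝔭 h𝔭 he hf ι' hι'
      hΩK hΩp hL⟩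
  exact twinSplit_instance_of_three_frames W' N' K Dt' κ γ 𝔭 𝔭' ι' hK hκ hH1
    (stub_wanFrameSS W' N' K Dt' hss hsurj hN' hK hH hodd κ hκ γ 𝔭 h𝔭 he hf 𝔭' h𝔭' hne ι' hι') hMu

end Summit.BirchSwinnertonDyer.BirchSwinnertonDyer.Cruxes.TwinSplitIMCAtThreeGoodSS.ThreeFrames

end
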